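import Summits.BirchSwinnertonDyer.BirchSwinnertonDyer.Theorems.EisensteinPrimesMazurMCOnX1RankZeroInterludeDefs
import Summits.BirchSwinnertonDyer.Rank1Residual.Additive.KatoDescentRankOnePerrinRiou
import Literature.NumberTheory.EllipticCurves.Kato2004.PerrinRiouRatio
import Literature.NumberTheory.EllipticCurves.IwasawaAlgebraUnitTwistPair

/-!
# Sketch (ideator bsd-idea-11 g18, lens = nearmiss; rev 2 by g19 — docstrings only, critic V121 price P1; rev 3 by g19 —
# §4 added: the Λ-adic residual `KatoWedgeERL` + the PROVED datum-level equivalence four-term ⟺ wedge) — the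
# «Kato pair discriminant» road to the node of the Interlude, crux `EisensteinPrimes.MazurMCOnX1RankZero`
# (stmt-BirchSwinnertonDyer-19035), atom XI″ (v13: XI°) replaced by VALUATION-EXACT Perrin-Riou-up-to-a-unit for the
# quadratic twist — an open conjecture at an Eisenstein prime (print reaches it only up to `ℚ^×/F^×`).

Nothing is asserted: four `Prop`s (one over an INTERFACE binder `IsKatoPairDisc`, whose meaning is fixed in the
docstring and whose construction is the separate statement `KatoPairDiscExists`) and ONE proved composition
`charIdeal_eq_of_katoPair` (kernel-checked, no `sorry`): at a `K`-torsion-free member `V ∼ E` of the node, for every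
companion `(V', g, ϖ, ϖ', D, G₀)`, the Λ-adic Poitou–Tate identity `(𝔇) = (F·Δ)` (`KatoPairTransfer`) and the value
identity `‖𝔇(𝟙)‖ = ‖F(𝟙)‖` (`KatoBDPValue`, the residual atom; ⟺ `PerrinRiouUpToUnitAt PRRatio V' p` given the
published inputs — see the idea card) force the Kato pair defect `Δ = G₀/c` to be a unit of `Λ`, i.e.
`char X_ord(V/K_∞⁺) = (G₀)` — the conclusion block of `NodeConcl` at that datum. The tail
`NodeConcl ⟹ ISO ⟹ MazurMCOnX1RankZero` is the LEAD's v10 plumbing, untouched.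
-/

set_option linter.dupNamespace false
set_option autoImplicit false

noncomputable section

open scoped Classical MatrixGroups ModularForm

open CongruenceSubgroup WeierstrassCurve NumberField IsDedekindDomain Field
  Literature.NumberTheory.EllipticCurves Literature.NumberTheory.EllipticCurves.ModularForms
  Literature.NumberTheory.EllipticCurves.Rank1Residual Literature.NumberTheory.GaloisRepresentations
  Literature.NumberTheory.EllipticCurves.CyclotomicZp Literature.NumberTheory.EllipticCurves.Castella2018
  Literature.NumberTheory.QuadraticFields
  Summit.BirchSwinnertonDyer.BirchSwinnertonDyer.Theorems.InterludeWithTorsion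

namespace Summit.BirchSwinnertonDyer.BirchSwinnertonDyer.Cruxes.MazurMCOnX1RankZero.KatoDiscriminant

/-! ## §1 The transferred atom C⁺: Perrin-Riou up to a `p`-adic unit for the twist (tree node, instantiated) -/

/-- **C⁺ = PR^×(E^K, p) at the node.** At the Interlude node `(E, p, K, κ, γ)` with `r_an(E) = 0`, every minimal
model `W'` of the quadratic twist `E^{D_K}` satisfies the tree's Perrin-Riou-up-to-a-unit node
`PerrinRiouUpToUnitAt Kato2004.PRRatio W' p` (Kato's bottom class `κ_{W'}` has Perrin-Riou ratio `ℒ ≠ 0` with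
`v_p ℒ = v_p(L'(W',1)/(Ω_{W'}·Reg W'))`). STATUS (rev 2, critic V121 P1): this VALUATION-EXACT form is a CONJECTURE at
an Eisenstein `p` — NO proof in print or preprint. Print reaches Perrin-Riou's conjecture for `W'` only UP TO `ℚ^×/F^×`:
Burungale–Skinner–Tian–Wan arXiv:2409.01350 Cor. 6.5 (`p ∤ 6N`, (PR0) «up to `ℚ^×`», p. 5/59) / Thm. 6.4 (form-level,
`p ∤ 2N`, Conj. 6.1 «up to `F^×`», p. 59); their integral refinement pins `u_L ∈ ℤ_(p)^×` (p. 60) but the period constant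
`c(ω,γ,γ') ∈ 𝒪^×` needs `(irr_ℚ)` (Prop. 4.13 (ii), p. 43), false here (`W'[p] ≅ W[p] ⊗ ε_K` is reducible), and the
auxiliary field must satisfy `(D_L, N_{W'}) = 1` (p. 59), so `L = K` is not admissible; BDV 2021 is up to `ℚ^×`,
BPS 2019 / Büyükboduk 2016 need (absolute) irreducibility / big image. Over the node `C⁺ ⟸ MC(W) ∧ MC(W')`
(CGS 2025, PRE) by the CONVERSE of this road (`KatoBDPValue` docstring) — so there is NO second print path; the gain of
the road is structural only. [cite: BurungaleSkinnerTianWan2024, Conj. 6.1, Thm. 6.4, Cor. 6.5 and Prop. 4.13 (ii)]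
[cite: PerrinRiou1993AIF, §3.3] [cite: BurnsKuriharaSano2019, Conj. 2.8 (ii)] -/
def PRTwistAtNode : Prop :=
  ∀ (W : WeierstrassCurve ℚ) [W.IsElliptic] [W.IsGloballyMinimal] (p : ℕ) [Fact p.Prime]
    (K : Type) [Field K] [NumberField K] (κ : ZpExtension K p) (γ : absoluteGaloisGroup K),
    NodeHyp W p K κ γ → W.analyticRank = 0 →
    ∀ (W' : WeierstrassCurve ℚ) [W'.IsElliptic] [W'.IsGloballyMinimal],
      (∃ C : VariableChange ℚ, C • W' = W.quadraticTwist (NumberField.discr K : ℚ)) →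
      Summit.BirchSwinnertonDyer.Rank1Residual.Additive.PerrinRiouUpToUnitAt Kato2004.PRRatio W' p

/-! ## §2 The Kato pair discriminant: interface, construction statement, the Λ-adic transfer, the value atom -/

section Interface

/-! INTERFACE BINDER (definition request D-KPD). MEANING of `IsKatoPairDisc V V' p K κ γ₁ 𝔇`: `p` odd, split in
the imaginary quadratic `K`, `V'` a minimal model of `V^{D_K}`; `𝐳_V ∈ 𝐇¹_Γ(T_pV)` and `𝐳_{V'} ∈ 𝐇¹_Γ(T_pV')`
the Λ-adic lifts of the `p`-power lines of Kato's Néron-normalised zeta elements (the data (Z1)–(Z5) of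
`Kato2004.PRRatioBody`), read in `𝐇¹ := H¹_Iw(K_∞⁺, T_pV) = 𝐇¹_Γ(T_pV) ⊕ 𝐇¹_Γ(T_pV')` (Shapiro; `T_pV' ≅ T_pV ⊗ ε_K`,
`ε_K|_{G_{K_v̄}} = 1`); then `𝔇 ∈ Λ = ℤ_p⟦γ₁ − 1⟧` GENERATES `char_Λ( H¹_Iw(K_{∞,v̄}⁺, T_pV) / (Λ·loc_v̄ 𝐳_V + Λ·loc_v̄ 𝐳_{V'}) )`
(a torsion quotient of a rank-2 module: `loc_p z_V ∉ H¹_f` by Kato's reciprocity law since `L(V,1) ≠ 0`, `loc_p z_{V'}`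
Λ-independent of it by Rohrlich). Equivalently `𝔇 ≐ [L_{p,α}(f)L_{p,β}(g) − L_{p,β}(f)L_{p,α}(g)] / log_p(1+T)` up to
`Λ`-units and the anomalous `H²_Iw`-torsion (Perrin-Riou: `∧² 𝔏_V = log_p(1+T)·∧²`). A binder; nothing asserted. -/
variable (IsKatoPairDisc : ∀ (V : WeierstrassCurve ℚ) [V.IsElliptic] [V.IsGloballyMinimal]
    (V' : WeierstrassCurve ℚ) [V'.IsElliptic] [V'.IsGloballyMinimal] (p : ℕ) [Fact p.Prime]
    (K : Type) [Field K] [NumberField K] (κ : ZpExtension K p) (γ₁ : absoluteGaloisGroup K),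
    IwasawaAlgebra p → Prop)

/-- **CONSTRUCTION statement (support, PUB + kernel)**: at the node, for a frame and a `K`-torsion-free member
`V ∼ E` and a twist model `V'`, a Kato pair discriminant `𝔇` EXISTS (Kato Thm. 12.4–12.5: `𝐇¹_Γ` torsion-free of
rank one with the zeta line inside; Shapiro; `H¹_Iw(ℚ_p, T)` of rank 2; structure theory of `Λ`-modules).
[cite: Kato2004Asterisque, Thm. 12.4 (2) and Thm. 12.5 (pp. 221–222)] [cite: PerrinRiou1994Invent, §3.6.1] -/
def KatoPairDiscExists : Prop :=
  ∀ (W : WeierstrassCurve ℚ) [W.IsElliptic] [W.IsGloballyMinimal] (p : ℕ) [Fact p.Prime]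
    (K : Type) [Field K] [NumberField K] (κ : ZpExtension K p) (γ : absoluteGaloisGroup K),
    NodeHyp W p K κ γ →
    ∀ [NeZero (W.conductorNorm ℤ)] (f : CuspForm (Gamma0 (W.conductorNorm ℤ)) 2), IsNewformOf W f →
    ∀ [NeZero (NumberField.discr K).natAbs] (Φ : FrameData W p K κ γ f),
    ∀ (V : WeierstrassCurve ℚ) [V.IsElliptic] [V.IsGloballyMinimal], IsIsogenous W V →
      (∀ Q : (V.baseChange K).toAffine.Point, p • Q = 0 → Q = 0) →
    ∀ (V' : WeierstrassCurve ℚ) [V'.IsElliptic] [V'.IsGloballyMinimal],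
      (∃ C : VariableChange ℚ, C • V' = V.quadraticTwist (NumberField.discr K : ℚ)) →
      ∃ 𝔇 : IwasawaAlgebra p, IsKatoPairDisc V V' p K κ Φ.γ₁ 𝔇

/-- **KATO PAIR TRANSFER (crux-sized support; kernel algebra over PUBLISHED inputs, NO reciprocity law).** At the
node, frame `Φ`, `K`-torsion-free member `V ∼ E` with `char X_Gr(V/K_∞⁺) = (F)` (the output of
`PlusCharValueEqGreenbergValue`), and every companion `(V', g, ϖ, ϖ', D, G₀)` with `D` torsion, `char D = (c)` and
`G₀ = c·Δ` (the Kato pair defect `Δ = δ(V)δ(V')`, which EXISTS by Kato–Wüthrich divisibility on the two lines —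
`PublishedFacts`): the Kato pair discriminant satisfies **`(𝔇) = (F·Δ)`** in `Λ`. Proof in print-free words: global
Poitou–Tate over `K_∞⁺` for the structures (rel_v, str_v̄) ⊂ (rel_v, rel_v̄) applied to the rank-2 Kato lattice
`𝐙 ⊂ 𝐇¹`; `𝔖_{rel,str} = 0` since `X_Gr` is torsion and `𝐇¹` is torsion-free [TF]; `char X_{str,str}` cancels against
the Kato defects `δ(·) = char(𝐇¹_Γ/𝐳)/char X_str` (Kato Thm. 12.5 (3) read on each line); `char X_{str_v,rel_v̄} =
char X_{rel_v,str_v̄}` by complex conjugation. WHY IT MIGHT FAIL: only through the bookkeeping of the anomalous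
`H²_Iw(K_v̄,T)[γ₁−1]` and of `V(K)[p] = 0` (the same finite local terms CGS Prop. 3.4.2 carries); the identity is
otherwise formal. [cite: Kato2004Asterisque, Thm. 12.5 (3)–(4) (p. 222) and §17.13] [cite: Wuthrich2014, Thm. 16]
[cite: PerrinRiou1994Invent, §3.6.1 and A.3] [cite: CastellaGrossiSkinner2025, Prop. 3.4.2 and proof of Prop. 4.2.1 (PT1)/(PT2)] -/
def KatoPairTransfer : Prop :=
  ∀ (W : WeierstrassCurve ℚ) [W.IsElliptic] [W.IsGloballyMinimal] (p : ℕ) [Fact p.Prime]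
    (K : Type) [Field K] [NumberField K] (κ : ZpExtension K p) (γ : absoluteGaloisGroup K),
    NodeHyp W p K κ γ →
    ∀ [NeZero (W.conductorNorm ℤ)] (f : CuspForm (Gamma0 (W.conductorNorm ℤ)) 2), IsNewformOf W f →
    ∀ [NeZero (NumberField.discr K).natAbs] (Φ : FrameData W p K κ γ f) [Fact (κ.IsTopGenerator Φ.γ₁)],
    ∀ (V : WeierstrassCurve ℚ) [V.IsElliptic] [V.IsGloballyMinimal], IsIsogenous W V →
      (∀ Q : (V.baseChange K).toAffine.Point, p • Q = 0 → Q = 0) →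
    ∀ (F : IwasawaAlgebra p),
      AcSelmer.XAc.charIdeal (V.baseChange K) p κ Φ.vbar ∅ Φ.γ₁ = Ideal.span {F} →
      PowerSeries.constantCoeff F ≠ 0 →
    ∀ (V' : WeierstrassCurve ℚ) [V'.IsElliptic] [V'.IsGloballyMinimal],
      (∃ C : VariableChange ℚ, C • V' = V.quadraticTwist (NumberField.discr K : ℚ)) →
    ∀ [NeZero (V'.conductorNorm ℤ)] (g : CuspForm (Gamma0 (V'.conductorNorm ℤ)) 2), IsNewformOf V' g →
    ∀ (ϖ : ℚ), (ϖ : ℝ) * V.realPeriodRat = plusPeriod f →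
    ∀ (ϖ' : ℚ), (ϖ' : ℝ) * V'.realPeriodRat = plusPeriod g →
    ∀ (D : (V.baseChange K).SelmerDualData κ γ) (G₀ : IwasawaAlgebra p),
      iwasawaToPowerSeries p G₀ =
        PowerSeries.C ((ϖ * ϖ' : ℚ) : ℚ_[p]) *
          (padicLFunction f (unitRoot V p : ℚ_[p]) * padicLFunction g (unitRoot V' p : ℚ_[p])) →
    ∀ (c Δ : IwasawaAlgebra p), D.IsTorsion → D.charIdeal = Ideal.span {c} → G₀ = c * Δ →
    ∀ (𝔇 : IwasawaAlgebra p), IsKatoPairDisc V V' p K κ Φ.γ₁ 𝔇 →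
      Ideal.span {𝔇} = Ideal.span {F * Δ}

/-- **(KBV) — THE RESIDUAL ATOM: the Kato pair discriminant at the trivial character has the `p`-adic size of the
Greenberg value.** Same binders; conclusion `‖𝔇(𝟙)‖_p = ‖F(𝟙)‖_p`. By Kato's reciprocity law at `𝟙` for `V`
(`exp*_ω κ_V ≐ (#Ẽ(𝔽_p)/p)·L(V,1)/Ω_V`), the definition of the Perrin-Riou ratio of `V'` (`log_ω κ_{V'} = ℒ'·log_ω(P')²`),
Step 1 (`‖F(𝟙)‖ = ‖𝓛_v^Gr(f/K)(𝟙)‖ ≐ ‖((#Ẽ(𝔽_p)/p)·log_{ω}(y_K))²‖`, tree `PlusCharValueEqGreenbergValue` + CGLS/BDP) and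
Gross–Zagier–Kolyvagin bookkeeping (`[V'(ℚ):ℤ y_K^−]²`), (KBV) ⟺ `PerrinRiouUpToUnitAt PRRatio V' p` over the node —
status of the latter (rev 2): VALUATION-EXACT PR^× at an Eisenstein `p` is a CONJECTURE with no print or preprint
proof (BSTW Thm. 6.4 / Cor. 6.5 reach it only up to `F^×/ℚ^×`; `c(ω,γ,γ') ∈ 𝒪^×` needs `(irr_ℚ)`, Prop. 4.13 (ii));
its only print derivation is `MC(V) ∧ MC(V')` (CGS 2025, PRE) ⟹ (KBV), the converse of this road. Heights never
enter (`F(𝟙) ≠ 0`). WHY IT MIGHT FAIL: it is EQUIVALENT over the node to `MC(V) ∧ MC(V')` (no strength reduction is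
claimed, and no second print path exists); as typed it could only fail with Mazur's Main Conjecture at that row.
[cite: BurungaleSkinnerTianWan2024, Conj. 6.1, Thm. 6.4, Cor. 6.5, Prop. 4.13 (ii)]
[cite: Kato2004Asterisque, Thm. 12.5 (1) (p. 221)] [cite: CastellaGrossiLeeSkinner2022, Thm. 5.1.3] [cite: GrossZagier1986, Thm. I.6.3] -/
def KatoBDPValue : Prop :=
  ∀ (W : WeierstrassCurve ℚ) [W.IsElliptic] [W.IsGloballyMinimal] (p : ℕ) [Fact p.Prime]
    (K : Type) [Field K] [NumberField K] (κ : ZpExtension K p) (γ : absoluteGaloisGroup K),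
    NodeHyp W p K κ γ →
    ∀ [NeZero (W.conductorNorm ℤ)] (f : CuspForm (Gamma0 (W.conductorNorm ℤ)) 2), IsNewformOf W f →
    ∀ [NeZero (NumberField.discr K).natAbs] (Φ : FrameData W p K κ γ f) [Fact (κ.IsTopGenerator Φ.γ₁)],
    ∀ (V : WeierstrassCurve ℚ) [V.IsElliptic] [V.IsGloballyMinimal], IsIsogenous W V →
      (∀ Q : (V.baseChange K).toAffine.Point, p • Q = 0 → Q = 0) →
    ∀ (F : IwasawaAlgebra p),
      AcSelmer.XAc.charIdeal (V.baseChange K) p κ Φ.vbar ∅ Φ.γ₁ = Ideal.span {F} →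
      PowerSeries.constantCoeff F ≠ 0 →
    ∀ (V' : WeierstrassCurve ℚ) [V'.IsElliptic] [V'.IsGloballyMinimal],
      (∃ C : VariableChange ℚ, C • V' = V.quadraticTwist (NumberField.discr K : ℚ)) →
    ∀ (𝔇 : IwasawaAlgebra p), IsKatoPairDisc V V' p K κ Φ.γ₁ 𝔇 →
      ‖((PowerSeries.constantCoeff 𝔇 : ℤ_[p]) : ℚ_[p])‖ = ‖((PowerSeries.constantCoeff F : ℤ_[p]) : ℚ_[p])‖

/-! ## §3 The proved composition: transfer + value ⟹ the Kato pair defect is a unit ⟹ `char X_ord(V/K_∞⁺) = (G₀)` -/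

/-- Skinner–Urban-type closing, kernel: in `Λ = ℤ_p⟦T⟧`, if `(𝔇) = (F·Δ)` and `‖𝔇(0)‖ = ‖F(0)‖ ≠ 0` then `Δ ∈ Λˣ`.
[cite: Washington1997, §13.2] [cite: SkinnerUrban2014, Lemma 3.2] -/
theorem isUnit_of_span_eq_of_norm_constantCoeff_eq {p : ℕ} [Fact p.Prime] {𝔇 F Δ : IwasawaAlgebra p}
    (hspan : Ideal.span {𝔇} = Ideal.span {F * Δ}) (hF : PowerSeries.constantCoeff F ≠ 0)
    (hval : ‖((PowerSeries.constantCoeff 𝔇 : ℤ_[p]) : ℚ_[p])‖ =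
      ‖((PowerSeries.constantCoeff F : ℤ_[p]) : ℚ_[p])‖) : IsUnit Δ := by
  rw [Ideal.span_singleton_eq_span_singleton] at hspan
  obtain ⟨u, hu⟩ := hspan
  -- `𝔇 * u = F * Δ`; compare constant coefficients
  have hcoeff : PowerSeries.constantCoeff F * PowerSeries.constantCoeff Δ =
      PowerSeries.constantCoeff 𝔇 * PowerSeries.constantCoeff (u : IwasawaAlgebra p) := by
    rw [← map_mul, ← map_mul, hu]
  have hu1 : ‖((PowerSeries.constantCoeff (u : IwasawaAlgebra p) : ℤ_[p]) : ℚ_[p])‖ = 1 := by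
    rw [← PadicInt.norm_def]
    exact PadicInt.isUnit_iff.mp (PowerSeries.isUnit_iff_constantCoeff.mp u.isUnit)
  have hnorm : ‖((PowerSeries.constantCoeff F : ℤ_[p]) : ℚ_[p])‖ *
      ‖((PowerSeries.constantCoeff Δ : ℤ_[p]) : ℚ_[p])‖ =
      ‖((PowerSeries.constantCoeff F : ℤ_[p]) : ℚ_[p])‖ := by
    rw [← norm_mul, ← PadicInt.coe_mul, hcoeff, PadicInt.coe_mul, norm_mul, hu1, mul_one, hval]
  have hF' : ‖((PowerSeries.constantCoeff F : ℤ_[p]) : ℚ_[p])‖ ≠ 0 := by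
    rw [← PadicInt.norm_def]
    exact norm_ne_zero_iff.mpr hF
  have hΔ1 : ‖((PowerSeries.constantCoeff Δ : ℤ_[p]) : ℚ_[p])‖ = 1 := by
    have := hnorm
    field_simp at this
    simpa using this
  rw [PowerSeries.isUnit_iff_constantCoeff, PadicInt.isUnit_iff, PadicInt.norm_def]
  exact hΔ1

/-- **THE ROAD, COMPOSED (kernel-checked): `KatoPairDiscExists ∧ KatoPairTransfer ∧ KatoBDPValue` give, at every
`K`-torsion-free member `V ∼ E` of the node carrying the Step-1 generator `F` of `char X_Gr(V/K_∞⁺)` with `F(𝟙) ≠ 0`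
(= the output of the tree's `PlusCharValueEqGreenbergValue`), for every companion `(V', g, ϖ, ϖ', D, G₀)` with `D`
torsion, `char D = (c)` and `G₀ = c·Δ`: `char D = (G₀)`** — the conclusion block of `NodeConcl V p K κ γ f` at that
datum (the two-line main conjecture over `K_∞⁺`, whence `MC(V) ∧ MC(V')` by the two-line Euler characteristic and
`MazurMCOnX1RankZero` by the LEAD's v10 tail). No reciprocity law, no Beilinson–Flach class, no `Λ^ur`, no road-B
input is used on this road; the NON-PUB content sits in `KatoBDPValue` alone (⟺ valuation-exact PR^× of the twist:
an open conjecture at an Eisenstein `p`, print only up to `ℚ^×/F^×` — rev 2).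
[cite: CastellaGrossiSkinner2025, §5 (Interlude) and Thm. 7.2.3] [cite: BurungaleSkinnerTianWan2024, Conj. 6.1 and Cor. 6.5] -/
theorem charIdeal_eq_of_katoPair (hEx : KatoPairDiscExists IsKatoPairDisc)
    (hT : KatoPairTransfer IsKatoPairDisc) (hV : KatoBDPValue IsKatoPairDisc) :
    ∀ (W : WeierstrassCurve ℚ) [W.IsElliptic] [W.IsGloballyMinimal] (p : ℕ) [Fact p.Prime]
      (K : Type) [Field K] [NumberField K] (κ : ZpExtension K p) (γ : absoluteGaloisGroup K),
      NodeHyp W p K κ γ →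
      ∀ [NeZero (W.conductorNorm ℤ)] (f : CuspForm (Gamma0 (W.conductorNorm ℤ)) 2), IsNewformOf W f →
      ∀ [NeZero (NumberField.discr K).natAbs] (Φ : FrameData W p K κ γ f) [Fact (κ.IsTopGenerator Φ.γ₁)],
      ∀ (V : WeierstrassCurve ℚ) [V.IsElliptic] [V.IsGloballyMinimal], IsIsogenous W V →
        (∀ Q : (V.baseChange K).toAffine.Point, p • Q = 0 → Q = 0) →
      ∀ (F : IwasawaAlgebra p),
        AcSelmer.XAc.charIdeal (V.baseChange K) p κ Φ.vbar ∅ Φ.γ₁ = Ideal.span {F} →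
        PowerSeries.constantCoeff F ≠ 0 →
      ∀ (V' : WeierstrassCurve ℚ) [V'.IsElliptic] [V'.IsGloballyMinimal],
        (∃ C : VariableChange ℚ, C • V' = V.quadraticTwist (NumberField.discr K : ℚ)) →
      ∀ [NeZero (V'.conductorNorm ℤ)] (g : CuspForm (Gamma0 (V'.conductorNorm ℤ)) 2), IsNewformOf V' g →
      ∀ (ϖ : ℚ), (ϖ : ℝ) * V.realPeriodRat = plusPeriod f →
      ∀ (ϖ' : ℚ), (ϖ' : ℝ) * V'.realPeriodRat = plusPeriod g →
      ∀ (D : (V.baseChange K).SelmerDualData κ γ) (G₀ : IwasawaAlgebra p),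
        iwasawaToPowerSeries p G₀ =
          PowerSeries.C ((ϖ * ϖ' : ℚ) : ℚ_[p]) *
            (padicLFunction f (unitRoot V p : ℚ_[p]) * padicLFunction g (unitRoot V' p : ℚ_[p])) →
      ∀ (c Δ : IwasawaAlgebra p), D.IsTorsion → D.charIdeal = Ideal.span {c} → G₀ = c * Δ →
        D.charIdeal = Ideal.span {G₀} := by
  intro W _ _ p _ K _ _ κ γ hN _ f hf _ Φ _ V _ _ hiso htor F hF hF0 V' _ _ hV' _ g hg ϖ hϖ ϖ' hϖ' D G₀ hG₀
    c Δ hD hc hΔ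
  obtain ⟨𝔇, h𝔇⟩ := hEx W p K κ γ hN f hf Φ V hiso htor V' hV'
  have hspan := hT W p K κ γ hN f hf Φ V hiso htor F hF hF0 V' hV' g hg ϖ hϖ ϖ' hϖ' D G₀ hG₀ c Δ hD hc hΔ 𝔇 h𝔇
  have hval := hV W p K κ γ hN f hf Φ V hiso htor F hF hF0 V' hV' 𝔇 h𝔇
  have hunit : IsUnit Δ := isUnit_of_span_eq_of_norm_constantCoeff_eq hspan hF0 hval
  rw [hc, hΔ]
  exact (Ideal.span_singleton_mul_right_unit hunit c).symm

/-! ## §4 (rev 3, g19) The Λ-adic residual of the road: the Kato wedge reciprocity law `ERL-K`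

Near-miss measurement one level up from (KBV). Take the KATO-BUILT class
`𝔷 := L_p(V')·res_K 𝐳_V − L_p(V)·res_K 𝐳_{V'} ∈ H¹_Iw(K_∞⁺, T_pV) = 𝐇¹_Γ(T_pV) ⊕ 𝐇¹_Γ(T_pV')` (Shapiro). By Kato's
reciprocity law on the two lines, `Col⁻_v(p⁻ loc_v 𝔷) = L_p(V')L_p(V) − L_p(V)L_p(V') = 0`, so `𝔷 ∈ 𝔖_{ord_v, rel_v̄}` — a
rank-one torsion-free `Λ`-module ([TF] + Poitou–Tate Euler characteristic) — while at `v̄` complex conjugation flips the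
sign of the `V'`-summand (`ε_K(c) = −1`), so `P(𝔷) := Col⁻_v̄(p⁻ loc_v̄ 𝔷) = 2·L_p(V)L_p(V') ≐ 2·G₀` (PR type, `p` odd)
and `Q(𝔷) := Col⁺_v(loc_v 𝔷) =: 𝔈` with `(𝔈) = (𝔇)` (`Col⁺ ∧ Col⁻ = Col_ω ∧ Col_{ω*}` on `∧² H¹_Iw(ℚ_p, T)`, so the Kato pair
discriminant is the `2 × 2` Coleman Wronskian `[L_{p,α}(f)L_{p,β}(g) − L_{p,β}(f)L_{p,α}(g)]/log_p(1+T)` up to `Λˣ`).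
Global duality for (ord_v, str_v̄) ⊂ (ord_v, rel_v̄) and (str_v, rel_v̄) ⊂ (ord_v, rel_v̄) applied to `Λ𝔷` gives
(I1) `(P)·char X_{ord,str} = (t)·char X_ord` and (I2) `(Q)·char X_{ord,str} = (t)·char X_Gr`, `t := char(𝔖_{ord,rel}/Λ𝔷)`,
whence `(𝔇)·char X_ord = (G₀)·char X_Gr`, i.e. `KatoPairTransfer` again (BF-free, PUB). The ONE statement this leaves is

  **ERL-K (Kato wedge reciprocity law):** `(J 𝔇) = (𝓛_v^Gr(f/K)|_{K_∞⁺})` in `𝒪_{ℂ_p}⟦T⟧`, typed `KatoWedgeERL` below —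
  «the image of the Kato-built ordinary class under the Coleman map AT `v` is the `+`-line BDP/Greenberg `p`-adic `L`-function».

STATUS (numbers, not adjectives). (1) ERL-K ⟸ CGS25 `thm:KLZ` at `α = 𝟙` restricted to `K_∞⁺` (⟸ BSTW arXiv:2409.01350 §5,
PREPRINT on 2026-08-29 evidence): `𝔖_{ord,rel}` has rank one and contains both `𝔷` and `BF⁺_𝟙`, and (a) of `thm:KLZ` gives
`P(BF⁺_𝟙) ≐ G₀`, so `𝔷 = 2u·BF⁺_𝟙` in `𝔖 ⊗ Frac Λ` and (b) of `thm:KLZ` transports to `Q(𝔷) ≐ L_Gr⁺` — SAME rider, SAME tier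
as XI″/XI° (PRE ↔ PRE; no strength reduction claimed). (2) Conversely and EXACTLY: over the transfer `(𝔇) = (F·Δ)`, ERL-K at the
datum ⟺ print's four-term identity (XI″'s `∃ a b ≠ 0, …` clause) at the datum, with the error pair `(a, b) = (Δ, 1)` — PROVED
below (`fourTerm_iff_span_map_eq`, `fourTermAt_iff_wedgeERLAt`; ideal algebra in a domain, `J` injective by `Φ.J_compat`).
So ERL-K is not a new conjecture: it is XI″'s content in BF-free clothes, and XI° follows from it by the tree's
`crossTransferSome_of_fourTermSome`. (3) Its value at `𝟙` is (KBV): `𝔇(𝟙) = W'(0) = (L(f,1)/Ω_f⁺)·[(1−1/α)² L'_{p,β}(g,0) −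
(1−1/β)² L'_{p,α}(g,0)] = −(L(f,1)/Ω_f⁺)·[(1−1/α)(1−1/β)]²·{(1−1/α)⁻² L'_{p,α}(g) − (1−1/β)⁻² L'_{p,β}(g)}` — the braces are
EXACTLY the Perrin-Riou–Rubin quantity of the rank-one curve `A = E^K` (BPS arXiv:1811.08216 Thm. 1.1.4 display), so
(KBV) ⟺ the valuation-exact Perrin-Riou–Rubin formula for `E^K`; BPS prove it assuming `ρ̄_A` ABSOLUTELY IRREDUCIBLE (p. 4,
§1.1.2) and, for `λ = β`, Hansen's announced `𝔏_PR^{(β)} = c_β·𝒟_{f^β}` (Thm. 6.1.2) — not available at an Eisenstein `p`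
(`A[p] ≅ E[p] ⊗ ε_K` reducible). Second door, same lock. (4) Cheapest falsifier (numerical, kit 0 here — for the critic):
on an open X1 row `(E, p, K)` compute `v_p` of the braces by overconvergent modular symbols (Pollack–Stevens, both slopes) and
compare with `v_p(((p+1−a_p)/p)²·log_ω(y_K)²/δ_A)`; inequality kills (KBV) hence MC at that row — either outcome is news.
[cite: CastellaGrossiSkinner2025, Thm. 4.1.1 (a)–(b), Prop. 4.2.1, Prop. 2.2.4] [cite: BurungaleSkinnerTianWan2024, §5]
[cite: Kato2004Asterisque, Thm. 12.5, §16.6, §17.13] [cite: PerrinRiou1994Invent, §3.4–§3.6, A.3]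
[cite: BuyukbodukPollackSasaki2018, Thm. 1.1.1, Thm. 1.1.4, Thm. 6.1.2 (arXiv:1811.08216)] -/

/-- **ERL-K — the Kato wedge reciprocity law (the Λ-adic residual of the road; PRE, same rider as XI″).** Shape of XI″:
at the node, for a frame `Φ`, SOME member `V ∼ E` with `Good ∧ Red ∧ Heeg` satisfies: for every twist model `V'` and every
Kato pair discriminant `𝔇` of `(V, V')`, `(PowerSeries.map Φ.J 𝔇) = (UnrSeries₂.plus Φ.G)` as ideals of `𝒪_{ℂ_p}⟦T⟧`.
Member-sensitive on both sides of the transfer exactly as XI″ is (`μ` of `X_Gr` and the Néron normalisation of `𝐳_V` move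
together under `p`-isogeny). WHY IT MIGHT FAIL: only through the PRE rider (BSTW §5 at `p ∣ #E(𝔽_p)`-type Eisenstein `p`,
`p = 3` via [SV-S-Ohta]); as typed it is implied by XI″ ∧ `KatoPairTransfer` (item (2) above).
[cite: CastellaGrossiSkinner2025, Thm. 4.1.1, Prop. 4.2.1] [cite: BurungaleSkinnerTianWan2024, §5] [cite: Kato2004Asterisque, Thm. 12.5] -/
def KatoWedgeERL : Prop :=
  ∀ (W : WeierstrassCurve ℚ) [W.IsElliptic] [W.IsGloballyMinimal] (p : ℕ) [Fact p.Prime]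
    (K : Type) [Field K] [NumberField K] (κ : ZpExtension K p) (γ : absoluteGaloisGroup K),
    NodeHyp W p K κ γ →
    ∀ [NeZero (W.conductorNorm ℤ)] (f : CuspForm (Gamma0 (W.conductorNorm ℤ)) 2), IsNewformOf W f →
    ∀ [NeZero (NumberField.discr K).natAbs] (Φ : FrameData W p K κ γ f) [Fact (κ.IsTopGenerator Φ.γ₁)],
    ∃ (V : WeierstrassCurve ℚ) (_ : V.IsElliptic) (_ : V.IsGloballyMinimal),
      IsIsogenous W V ∧ Good V p ∧ Red V p ∧ SatisfiesHeegnerHypothesis (V.conductorNorm ℤ) K ∧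
      (UnrSeries₂.plus Φ.G ≠ 0 →
        ∀ (V' : WeierstrassCurve ℚ) [V'.IsElliptic] [V'.IsGloballyMinimal],
          (∃ C : VariableChange ℚ, C • V' = V.quadraticTwist (NumberField.discr K : ℚ)) →
        ∀ (𝔇 : IwasawaAlgebra p), IsKatoPairDisc V V' p K κ Φ.γ₁ 𝔇 →
          Ideal.span {PowerSeries.map Φ.J 𝔇} = Ideal.span {UnrSeries₂.plus Φ.G})

/-- Ring homomorphisms preserve association. [folklore] -/
private theorem associated_map {R S : Type*} [CommRing R] [CommRing S] (φ : R →+* S) {x y : R}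
    (h : Associated x y) : Associated (φ x) (φ y) := by
  obtain ⟨u, hu⟩ := h
  exact ⟨Units.map (φ : R →* S) u, by rw [← hu, map_mul]; rfl⟩

/-- **Four-term ⟺ wedge, abstract form (kernel).** In a domain `R` mapped injectively into a domain `S` by `φ`, with
`c ≠ 0`, `L ≠ 0`, `G₀ = c·Δ` and the transfer `(𝔇) = (F·Δ)`: print's four-term clause
`∃ a b ≠ 0, (G₀ b) = (a)(c) ∧ (L·φb) = (φa)·φ(F)` holds iff `(φ𝔇) = (L)`; the witness backwards is `(a, b) = (Δ, 1)`.
[cite: CastellaGrossiSkinner2025, Prop. 4.2.1 ((PT1)/(PT2)/(cc))] -/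
theorem fourTerm_iff_span_map_eq {R S : Type*} [CommRing R] [IsDomain R] [CommRing S] [IsDomain S]
    (φ : R →+* S) (hφ : Function.Injective φ) {c Δ F 𝔇 G₀ : R} {L : S}
    (hc : c ≠ 0) (hL : L ≠ 0) (hG : G₀ = c * Δ) (hD : Ideal.span {𝔇} = Ideal.span {F * Δ}) :
    (∃ a b : R, a ≠ 0 ∧ b ≠ 0 ∧ Ideal.span {G₀ * b} = Ideal.span {a} * Ideal.span {c} ∧
        Ideal.span {L * φ b} = Ideal.span {φ a} * (Ideal.span {F}).map φ) ↔
      Ideal.span {φ 𝔇} = Ideal.span {L} := by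
  have hmap : (Ideal.span {F}).map φ = Ideal.span {φ F} := by rw [Ideal.map_span, Set.image_singleton]
  have hD' : Associated 𝔇 (F * Δ) := Ideal.span_singleton_eq_span_singleton.mp hD
  have hφD : Associated (φ 𝔇) (φ Δ * φ F) := by
    simpa [map_mul, mul_comm] using associated_map φ hD'
  rw [hmap]
  constructor
  · rintro ⟨a, b, _, hb, h1, h2⟩
    rw [Ideal.span_singleton_mul_span_singleton, Ideal.span_singleton_eq_span_singleton, hG] at h1
    have h1' : Associated (c * (Δ * b)) (c * a) := by
      simpa [mul_comm, mul_assoc, mul_left_comm] using h1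
    have hΔb : Associated (Δ * b) a := h1'.of_mul_left (Associated.refl c) hc
    rw [Ideal.span_singleton_mul_span_singleton, Ideal.span_singleton_eq_span_singleton] at h2
    have h3 : Associated (φ a * φ F) ((φ Δ * φ F) * φ b) := by
      simpa [map_mul, mul_comm, mul_assoc, mul_left_comm] using (associated_map φ hΔb.symm).mul_right (φ F)
    have hφb : φ b ≠ 0 := (map_ne_zero_iff φ hφ).mpr hb
    have h5 : Associated L (φ Δ * φ F) := (h2.trans h3).of_mul_right (Associated.refl (φ b)) hφb
    exact Ideal.span_singleton_eq_span_singleton.mpr (hφD.trans h5.symm)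
  · intro h
    have h' : Associated (φ 𝔇) L := Ideal.span_singleton_eq_span_singleton.mp h
    have h𝔇 : φ 𝔇 ≠ 0 := h'.ne_zero_iff.mpr hL
    have hΔ : Δ ≠ 0 := by
      have hFΔ : φ Δ * φ F ≠ 0 := hφD.ne_zero_iff.mp h𝔇
      exact fun h0 => hFΔ (by rw [h0, map_zero, zero_mul])
    refine ⟨Δ, 1, hΔ, one_ne_zero, ?_, ?_⟩
    · rw [hG, mul_one, Ideal.span_singleton_mul_span_singleton, mul_comm]
    · rw [map_one, mul_one, Ideal.span_singleton_mul_span_singleton, Ideal.span_singleton_eq_span_singleton]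
      exact h'.symm.trans hφD

/-- **Four-term ⟺ wedge AT THE INTERLUDE DATUM (kernel).** With `Λ = ℤ_p⟦T⟧`, a structure map `J : ℤ_p → 𝒪_{ℂ_p}` compatible
with `ℤ_p ⊆ ℚ_p ⊆ ℂ_p` (the clause `FrameData.J_compat`), `char D = (c)` with `c ≠ 0`, `char X_Gr = (F)`, `G₀ = c·Δ`, the
transfer `(𝔇) = (F·Δ)` (conclusion of `KatoPairTransfer`) and `L = UnrSeries₂.plus Φ.G ≠ 0`: the `∃ a b` clause of XI″
(`FourTermAtSomeLattice`) at this datum holds iff ERL-K holds at this datum. Use: `J := Φ.J`, `hJ := Φ.J_compat`,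
`I_D := D.charIdeal`, `I_X := AcSelmer.XAc.charIdeal (V.baseChange K) p κ Φ.vbar ∅ Φ.γ₁`.
[cite: CastellaGrossiSkinner2025, Prop. 4.2.1] -/
theorem fourTermAt_iff_wedgeERLAt {p : ℕ} [Fact p.Prime] (J : ℤ_[p] →+* PadicComplexInt p)
    (hJ : ∀ x : ℤ_[p], ((J x : PadicComplexInt p) : ℂ_[p]) = ((x : ℚ_[p]) : ℂ_[p]))
    {c Δ F 𝔇 G₀ : IwasawaAlgebra p} {L : PowerSeries (PadicComplexInt p)} {I_D I_X : Ideal (IwasawaAlgebra p)}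
    (hID : I_D = Ideal.span {c}) (hIX : I_X = Ideal.span {F}) (hc : c ≠ 0) (hL : L ≠ 0) (hG : G₀ = c * Δ)
    (hD : Ideal.span {𝔇} = Ideal.span {F * Δ}) :
    (∃ a b : IwasawaAlgebra p, a ≠ 0 ∧ b ≠ 0 ∧ Ideal.span {G₀ * b} = Ideal.span {a} * I_D ∧
        Ideal.span {L * PowerSeries.map J b} =
          Ideal.span {PowerSeries.map J a} * I_X.map (PowerSeries.map J)) ↔
      Ideal.span {PowerSeries.map J 𝔇} = Ideal.span {L} := by
  have hinj : Function.Injective (PowerSeries.map J) := by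
    rw [eq_padicIntToComplexInt_of_coe_eq hJ]
    exact PowerSeries.map_injective _ IntSeries.padicIntToComplexInt_injective
  subst hID hIX
  exact fourTerm_iff_span_map_eq (PowerSeries.map J) hinj hc hL hG hD

end Interface

end Summit.BirchSwinnertonDyer.BirchSwinnertonDyer.Cruxes.MazurMCOnX1RankZero.KatoDiscriminant

end
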